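import Summits.AtomisticToContinuum.HydrodynamicLimit.Theses.RelayRaceLocality
import Summits.AtomisticToContinuum.HydrodynamicLimit.Theorems.RelayRaceLocalityNearConstantShortTimeHLTiltL2Assembly
import Summits.AtomisticToContinuum.HydrodynamicLimit.Theorems.RelayRaceLocalityNearConstantShortTimeHLEndgamePX
import Summits.AtomisticToContinuum.HydrodynamicLimit.Theorems.RelayRaceLocalityNearConstantShortTimeHLEndgameI
import Summits.AtomisticToContinuum.HydrodynamicLimit.Theorems.RelayRaceLocalityNearConstantShortTimeHLEndgameTL
import Summits.AtomisticToContinuum.HydrodynamicLimit.Theorems.RelayRaceLocalityNearConstantShortTimeHLSplitTL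
import Summits.AtomisticToContinuum.HydrodynamicLimit.Theorems.NearConstantShortTimeHL.Negative.LoadBearing
import Summits.AtomisticToContinuum.HydrodynamicLimit.Theorems.NearConstantShortTimeHL.Negative.LawDichotomy
import HarnessLib

/-!
# Line `small-tilt-domination` for crux `NearConstantShortTimeHL` (stmt-AtomisticToContinuum-12502) — skeleton v25 "TL" (lead c10), final form of cycle 1

STATE at 2026-08-17T15:40Z: every provable piece of v25 is LANDED — `…TrueLawClosureDefs` p164768 (S2ᵀ, S3ᵀ, `DynamicTheoremTL`, `exists_goodEvents_of_tendsto`),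
`…GoodEventPackageTL` p165153 (`stub_goodEventPackageTL`), `…DynamicTL` p165692 (`stub_dynamicTL`), `…ReductionTL` p166205 (`stub_reductionTL`), `…EndgameTL` p167432
(`nearConstantShortTimeHL_of_dynamicsTL : TrueLawMomentumClosure → TrueLawEnergyClosure → TrueLawCapsPE → NearConstantShortTimeHL`), `…SplitTL` p168460 (route-level
split glue `nearConstantShortTimeHL_of_subsTL` over the three children inlined over Literature; `children-TL.json` attached as evidence). Registered OPEN stubs (3):
`stub_trueLawMomentumClosure`, `stub_trueLawEnergyClosure`, `stub_trueLawCapsPE` — the residue; both closure stubs audited CLEAN at the Lean level (evidence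
`TrueLawEnergyClosure-audit.md`, `TrueLawMomentumClosure-audit.md`). The v25 design header follows.


v25 (lead prover-line-stmt-AtomisticToContinuum-12502-c10-0, 2026-08-17T14:30Z) is an ARCHITECTURE RESHAPE of v24 after lead c9's waves priced
the ENERGY K-stub physics-false under EVERY admissible velocity cap (S3″/S3‴/S3⁗/S3⁵: needle beams, giant-driver Newton cradles, log-speed train
cradles — coherent microstructures of Gibbs cost `∝ (energy moved)/θ ∝ δ n`; evidence #65, #68; `Cruxes/…/Lines/small-tilt-domination-S3PQ-stub-false.md`,
`…-S3PX-stub-false.md`). DIAGNOSIS (lead c10): the wall is the equilibrium-event IMPORT, not the cap choice. The K-stubs are equilibrium LD bounds under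
the invariant drifted Gibbs law `G_N`, imported along the true law through `P_N ≤ e^{Cδ₀n} G_N` (`TiltDomination`); the import closes only if the rate
beats `Cδ₀`, and the Grönwall needs the defect threshold `δ → 0` on the diagonal grid while `δ₀` is fixed by the data — so the rate `c₀(M)` must be
UNIFORM in `δ` (it is chosen before `δ, τ, K` in `…ExpCapDefs` and feeds `δ₀ := c₀/(8CK)` in `…ReductionPX`). A `δ`-uniform rate is a SUPER-EXPONENTIAL
one-block estimate (true for stochastic lattice gases by noise, Kipnis–Landim Ch. 5); no cap family makes it true for deterministic hard spheres, and the
moment (Varadhan) form of the import leaves an additive `Cδ₀/b` entropy floor instead. REPAIR (same composition idea — relative-entropy Grönwall ∘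
means-pin dock ∘ closed statics): DROP THE IMPORT and type the closure inputs ALONG THE TRUE LAW as convergence in probability (the one-block /
local-equilibrium input of Yau 1991 §2, Olla–Varadhan–Yau 1993 §1/§4; for deterministic hard spheres the named open "derivation of local
equilibrium", Spohn 1991 §2.3–2.4):
* S2ᵀ/S3ᵀ `TrueLawMomentumClosure` / `TrueLawEnergyClosure` (reviewed Defs file `Theorems/…TrueLawClosureDefs.lean`, p164768): same binder as
  `TrueLawCapsPE`, then for every window `[s,s+τ] ⊆ [0,t]`, normalised test, `δ > 0`, cap level `K`:
  `P_N{packing cap ∧ integrated exponential cap ∧ δ < |windowed weak-form closure defect|} → 0`. WEAKER than the v24 residue (PX K-stubs + TiltDomination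
  ⇒ TL for near-constant data, `tendsto_zero_of_import`); not hit by any priced family (all exponentially rare along the true law).
* `DynamicTheoremTL` (same Defs file) = `DynamicTheoremPX` with `G, aI < c₀, hImp` deleted and `hKmom/hKen` replaced by Tendsto hypotheses along `P`.
* `stub_goodEventPackageTL` = `good_event_packagePX` fed by `P`-smallness through `exists_goodEvents_of_tendsto` (landed with the Defs) instead of
  import + rate gap; `stub_dynamicTL` = `stub_dynamicPX` verbatim over that package; `stub_reductionTL` = `stub_reductionPX` minus the import / reference
  box / rates (near-constancy becomes idle: Yau's method needs none; `TiltDomination` leaves the composition).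
Registered open stubs at the start of the cycle (6): `stub_trueLawMomentumClosure`, `stub_trueLawEnergyClosure`, `stub_trueLawCapsPE` (OPEN conjectures — the residue),
`stub_goodEventPackageTL`, `stub_dynamicTL`, `stub_reductionTL` (provable re-threads, wave 1 — all three LANDED); `NearConstantShortTimeHL_of` concludes the crux BY NAME.
Target of the pass: `nearConstantShortTimeHL_of_dynamicsTL : TrueLawMomentumClosure → TrueLawEnergyClosure → TrueLawCapsPE → NearConstantShortTimeHL`
(file `…EndgameTL`), then the split package TL (inlined children + glue). The v24 endgame `nearConstantShortTimeHL_of_dynamicsPX` (p162693) and the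
speed-capped fallback `nearConstantShortTimeHL_of_dynamics3` stay in the tree as records.

## Disproof used (`Cruxes/NearConstantShortTimeHL/Disproof.lean`, cycle 1, 2026-08-16T11:39Z, unchanged at 14:30Z 08-17; landed `Negative/LoadBearing`,
## `Negative/LawDichotomy`)
* `nearConstantShortTimeHLUntied_false` (tie load-bearing): consumed through S5a in `stub_reductionTL` (identification at `t = 0`, as in `…ReductionPX`).
* `nearConstantShortTimeHLNoPDE_false` (balance laws load-bearing): consumed in the dynamic theorem (Dafermos algebra) and S6 (isentropy).
* law dichotomy: every statement keeps `∀ N, IsProbabilityMeasure (P N)`; measurability caveat (§4) met by the jointly measurable flow (`…FlowFubini`).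
* No `-- Targets` section and no `stub_*_false`.
-/

noncomputable section

namespace Summit.AtomisticToContinuum.HydrodynamicLimit.Cruxes.NearConstantShortTimeHL.SmallTiltDomination

open scoped BigOperators Topology ENNReal
open Filter Set MeasureTheory
open Literature.MathematicalPhysics.KineticTheory Literature.Analysis.FluidPDE Literature.Analysis.FunctionSpaces
open Summit.AtomisticToContinuum.HydrodynamicLimit.Theses.RelayRaceLocality (NearConstantShortTimeHL)
open Summit.AtomisticToContinuum.HydrodynamicLimit.Theorems.NearConstantShortTimeHL
open Summit.AtomisticToContinuum.HydrodynamicLimit.Theorems.NearConstantShortTimeHLNegative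
  (NearConstantShortTimeHLUntied nearConstantShortTimeHLUntied_false
   NearConstantShortTimeHLNoPDE nearConstantShortTimeHLNoPDE_false)

/-! ## Scratch check against the landed negatives and the landed pieces -/

/-- The `t = 0` tie is load-bearing (landed). -/
example : ¬ NearConstantShortTimeHLUntied := nearConstantShortTimeHLUntied_false

/-- The Euler balance laws are load-bearing (landed). -/
example : ¬ NearConstantShortTimeHLNoPDE := nearConstantShortTimeHLNoPDE_false

/-- The statics side is closed (lead c7). -/
example : MesoscaleDensityLD := mesoscaleDensityLD_holds

/-- v24 over the tree (lead c9; rests on the physics-false S3⁵): the PX endgame. -/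
example : MomentumClosureTightnessPX → EnergyClosureTightnessPX → TrueLawCapsPE → NearConstantShortTimeHL := nearConstantShortTimeHL_of_dynamicsPX

/-- v18 over the tree (speed cap kept): the fallback endgame. -/
example : MomentumClosureTightnessI → EnergyClosureTightnessI → TrueLawCapsG → NearConstantShortTimeHL := nearConstantShortTimeHL_of_dynamics3

/-! ## Registered stubs (v25) -/

/-- **S2ᵀ — momentum closure in probability ALONG THE TRUE LAW** (OPEN, delegated-grade; the one-block input for the momentum flux). -/
theorem stub_trueLawMomentumClosure : TrueLawMomentumClosure := by
  sorry

/-- **S3ᵀ — energy closure in probability ALONG THE TRUE LAW** (OPEN, delegated-grade; the one-block input for the energy flux). -/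
theorem stub_trueLawEnergyClosure : TrueLawEnergyClosure := by
  sorry

/-- **S4‴ — a-priori caps along the true law: ball-packing cap + SUPER-EXPONENTIAL velocity tails in mean** (OPEN, delegated-grade; unchanged from v23). -/
theorem stub_trueLawCapsPE : TrueLawCapsPE := by
  sorry

/-! ## Composition -/

/-- **St2′ is a tree theorem** (statics closed, lead c7). -/
theorem superlinearityE_holds' : MesoscaleSuperlinearityE :=
  mesoscaleSuperlinearityE_of (positionMesoscaleLD_of_densityLD mesoscaleDensityLD_holds) (stub_velocityLD stub_ballGaussianEstimate)

/-- v25 over the tree: the TL endgame (lead c10, `…EndgameTL` p167432). -/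
example : TrueLawMomentumClosure → TrueLawEnergyClosure → TrueLawCapsPE → NearConstantShortTimeHL := nearConstantShortTimeHL_of_dynamicsTL

/-- **The line closes the crux modulo its stubs** (v25, final form of cycle 1): `stub_entropyToLLN (S6 (means-pin dock (reductionTL dynamicTL St2′ St3 S5a S2ᵀ S3ᵀ S4‴)))`
with `stub_reductionTL` / `stub_dynamicTL` the TREE theorems, concluding `RelayRaceLocality.NearConstantShortTimeHL` BY NAME — no `TiltDomination`, no equilibrium K-stub;
equivalently `nearConstantShortTimeHL_of_dynamicsTL stub_trueLawMomentumClosure stub_trueLawEnergyClosure stub_trueLawCapsPE`. -/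
theorem NearConstantShortTimeHL_of : NearConstantShortTimeHL :=
  stub_entropyToLLN
    (stub_meansToRelEntropy
      (meansConverge_of_nearConstantRelEntropy
        (stub_meansPin stub_ldaGeneralFamilies stub_concentrationGeneralFamilies
          (stub_reductionTL stub_dynamicTL superlinearityE_holds' stub_uniformPressure stub_staticLLN
            stub_trueLawMomentumClosure stub_trueLawEnergyClosure stub_trueLawCapsPE))))

end Summit.AtomisticToContinuum.HydrodynamicLimit.Cruxes.NearConstantShortTimeHL.SmallTiltDomination

end
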